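import Literature.NumberTheory.Sieve.HeathBrownCubicCubeSums
import Literature.NumberTheory.Sieve.HeathBrownCubicETermRearrangement
import HarnessLib

/-!
# Heath-Brown's Lemma 8.1: (8.5) summed over the class modulo `[J, q]`

Layer of the decomposition of **parity.S18**
(`Literature.NumberTheory.Sieve.setOf_prime_cube_add_two_mul_cube_infinite`) along D. R. Heath-Brown,
*Primes represented by `x³ + 2y³`*, Acta Math. 186 (2001), 1–84, continuing `HeathBrownCubicCubeSums`
((8.5) for one class modulo a rational integer `r`) and `HeathBrownCubicETermRearrangement` ((8.1) and
the class modulo `[J, q]`). In the proof of Lemma 8.1 (pp. 48–50):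

> "We therefore investigate the sum `∑_{β̂ ∈ 𝒞, β ≡ γ (mod r)} w'(N(β))` (8.2), where `r` is a rational
> integer multiple of `[J, q]`. To be specific, we shall take `r = N([J, q])`. … We now observe that
> `∑_{β̂ ∈ 𝒞, J ∣ β, β ≡ α (mod q)} w'(N(β))` is composed of `r³/N([J, q])` subsums of the form (8.2),
> whence `∑_{β̂ ∈ 𝒞, J ∣ β, β ≡ α (mod q)} w'(N(β)) = N([J, q])⁻¹𝓘 + O(S₀²(ξ log X)^n)`, providing that
> `(J, q) ∣ α`."

This file PROVES (for `𝐦` of length `n + 2`, the paper's `n ≥ 1`):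

* `sum_filter_sub_mem_eq_sum_classes` — a class modulo an ideal `𝔞 ∋ r` splits into the classes
  modulo `r` of the `ρ ∈ [0, r)³` with `coordElt ρ ∈ 𝔞` (`modVec`, `cubeMod` of
  `HeathBrownCubicLatticeCount`); `card_cubeMod_filter_mem_eq_sq` — there are `r³/N(𝔞) = r²` of them
  for `r = N(𝔞)` ("composed of `r³/N([J, q])` subsums");
* **`abs_sum_dvd_class_wDeriv_sub_le`** — the displayed conclusion with explicit constants: for a cube
  as in Lemma 3.8 (`CubeCond c₃ c₄ V`), `X ≥ 1`, `τ ≥ 0`, `J ≠ 0`, `q ≥ 1`, `N(J)q³ ≤ S₀` and ANY `α`,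
  `|∑_{β̂ ∈ 𝒞, J ∣ β, β ≡ α (mod q)} w'(N(β)) − [α ∈ J + (q)]·N(J ∩ (q))⁻¹𝓘| ≤ 2106(c₃²/c₄)S₀³V^{−1/3}(ξ log X)^n + 108S₀²(ξ log X)^{n+1}`
  (`w'(N(β))` at the ideal norm of `(β)`, which on the cube is the norm form, `absNorm_span_coordElt_real`;
  the incompatible case `(J, q) ∤ α` is an empty sum; the paper's `O(S₀²(ξ log X)^n)` absorbs the first
  term using `S₀ ≪ V^{1/3}`, `ξ log X ≫ 1`, facts of the application not imposed here).

What is NOT here: the case `n = 0` (Lemma 4.9), (8.7) (`HeathBrownCubicETermMainTerm`) and the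
Möbius sums of p. 51.

## References

* D. R. Heath-Brown, *Primes represented by `x³ + 2y³`*, Acta Math. 186 (2001), 1–84: §8, (8.2)
  (p. 48) and the paragraph after (8.6) (p. 50). [cite: HeathBrownActa2001, §8 (8.2)]

## Mathlib / tree search

Mathlib: `Finset.sum_fiberwise_of_maps_to`, `Finset.abs_sum_le_sum_abs`, `Ideal.absNorm_mem`.
Tree: `HeathBrownCubicCubeSums` (`HeathBrown2001_eq_8_5`, `castVec`, `mem_latticeCube_iff`),
`HeathBrownCubicETermRearrangement` (`absNorm_span_coordElt_real`, `exists_mem_and_dvd_sub_iff`,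
`dvd_span_and_dvd_sub_iff`, `absNorm_inf_span_le`, `inf_span_ne_bot`), `HeathBrownCubicLatticeCount`
(`modVec`, `cubeMod`, `coordElt_mem_iff_modVec`, `coordElt_mem_iff_of_sub_eq_smul`,
`exists_sub_modVec_eq_smul`, `modVec_add_smul`, `modVec_eq_self_of_mem`,
`card_cubeMod_filter_mem_mul_absNorm`, `coordElt_sub`, `coordElt_surjective`), `HeathBrownCubicTypeII`
(`CubeCond`, `latticeCube`, `wDeriv`), `HeathBrownCubicSiegelWalfisz` (`cubeIntegral`).
-/

noncomputable section

open Polynomial NumberField Finset MeasureTheory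

namespace Literature.NumberTheory.Sieve.CubicSieve

open LFunctions.CubeRootTwoField CubicPrimes

/-! ### A class modulo the ideal `𝔞 ∋ r` is a union of `r³/N(𝔞)` classes modulo `r` -/

section Classes

variable {X τ : ℝ}

/-- Coordinatewise divisibility of an integer vector by `r` means being an `r`-multiple. [folklore] -/
theorem dvd_coords_iff_exists_smul {r : ℤ} {w : ℤ × ℤ × ℤ} :
    (r ∣ w.1 ∧ r ∣ w.2.1 ∧ r ∣ w.2.2) ↔ ∃ t : ℤ × ℤ × ℤ, w = r • t := by
  constructor
  · rintro ⟨⟨t₁, h₁⟩, ⟨t₂, h₂⟩, ⟨t₃, h₃⟩⟩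
    exact ⟨(t₁, t₂, t₃), by ext <;> simp [h₁, h₂, h₃]⟩
  · rintro ⟨t, rfl⟩
    exact ⟨⟨t.1, by simp⟩, ⟨t.2.1, by simp⟩, ⟨t.2.2, by simp⟩⟩

open scoped Classical in
/-- **Splitting a class modulo an ideal into classes modulo a rational integer** (p. 50: the sum over
`β ≡ β₀ (mod [J, q])` "is composed of `r³/N([J, q])` subsums of the form (8.2)", `r = N([J, q])`): for an
ideal `𝔞 ∋ r` (`r ≥ 1`) and any finite set `s` of integer vectors,
`∑_{v ∈ s, coordElt v − coordElt v₀ ∈ 𝔞} G(v) = ∑_{ρ ∈ [0,r)³, coordElt ρ ∈ 𝔞} ∑_{v ∈ s, v ≡ v₀ + ρ (mod r)} G(v)`.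
[cite: HeathBrownActa2001, §8 p. 50] -/
theorem sum_filter_sub_mem_eq_sum_classes {𝔞 : Ideal (𝓞 K)} {r : ℕ} (hr : 0 < r)
    (hr𝔞 : ((r : ℤ) : 𝓞 K) ∈ 𝔞) (v₀ : ℤ × ℤ × ℤ) (s : Finset (ℤ × ℤ × ℤ)) (G : ℤ × ℤ × ℤ → ℝ) :
    ∑ v ∈ s.filter (fun v => coordElt v - coordElt v₀ ∈ 𝔞), G v =
      ∑ ρ ∈ (cubeMod r).filter (fun ρ => coordElt ρ ∈ 𝔞),
        ∑ v ∈ s.filter (fun v => (r : ℤ) ∣ v.1 - (v₀ + ρ).1 ∧ (r : ℤ) ∣ v.2.1 - (v₀ + ρ).2.1 ∧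
            (r : ℤ) ∣ v.2.2 - (v₀ + ρ).2.2), G v := by
  set s' := s.filter (fun v => coordElt v - coordElt v₀ ∈ 𝔞) with hs'
  set t := (cubeMod r).filter (fun ρ => coordElt ρ ∈ 𝔞) with ht
  have hmaps : ∀ v ∈ s', modVec r (v - v₀) ∈ t := by
    intro v hv
    rw [hs', mem_filter, ← coordElt_sub] at hv
    rw [ht, mem_filter]
    exact ⟨modVec_mem_cubeMod hr _, (coordElt_mem_iff_modVec hr𝔞 _).mp hv.2⟩
  rw [← Finset.sum_fiberwise_of_maps_to hmaps]
  refine Finset.sum_congr rfl fun ρ hρ => ?_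
  rw [ht, mem_filter] at hρ
  obtain ⟨hρcube, hρ𝔞⟩ := hρ
  -- the fibre over `ρ` is the class `v ≡ v₀ + ρ (mod r)`
  congr 1
  ext v
  simp only [hs', mem_filter, Prod.fst_add, Prod.snd_add]
  constructor
  · rintro ⟨⟨hv, -⟩, hmod⟩
    obtain ⟨u, hu⟩ := exists_sub_modVec_eq_smul r (v - v₀)
    rw [hmod] at hu
    have h : v - (v₀ + ρ) = (r : ℤ) • u := by rw [← hu]; abel
    have := (dvd_coords_iff_exists_smul (r := (r : ℤ)) (w := v - (v₀ + ρ))).mpr ⟨u, h⟩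
    simpa only [Prod.fst_sub, Prod.snd_sub, Prod.fst_add, Prod.snd_add] using ⟨hv, this⟩
  · rintro ⟨hv, h1, h2, h3⟩
    have hdvd : ((r : ℤ) ∣ (v - (v₀ + ρ)).1 ∧ (r : ℤ) ∣ (v - (v₀ + ρ)).2.1 ∧
        (r : ℤ) ∣ (v - (v₀ + ρ)).2.2) := by
      simpa only [Prod.fst_sub, Prod.snd_sub, Prod.fst_add, Prod.snd_add] using ⟨h1, h2, h3⟩
    obtain ⟨u, hu⟩ := dvd_coords_iff_exists_smul.mp hdvd
    have hvv₀ : v - v₀ = ρ + (r : ℤ) • u := by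
      have : v - v₀ = (v - (v₀ + ρ)) + ρ := by abel
      rw [this, hu]; abel
    have hsub : v - v₀ - ρ = (r : ℤ) • u := by rw [hvv₀]; abel
    refine ⟨⟨hv, ?_⟩, ?_⟩
    · rw [← coordElt_sub, coordElt_mem_iff_of_sub_eq_smul hr𝔞 hsub]
      exact hρ𝔞
    · rw [hvv₀, modVec_add_smul, modVec_eq_self_of_mem hρcube]

open scoped Classical in
/-- The number of classes modulo `r = N(𝔞)` making up a class modulo `𝔞`: `r³/N(𝔞) = r²`.
[cite: HeathBrownActa2001, §8 p. 50] -/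
theorem card_cubeMod_filter_mem_eq_sq {𝔞 : Ideal (𝓞 K)} (h𝔞 : 𝔞 ≠ ⊥) :
    ((cubeMod (Ideal.absNorm 𝔞)).filter (fun ρ => coordElt ρ ∈ 𝔞)).card = Ideal.absNorm 𝔞 ^ 2 := by
  set r := Ideal.absNorm 𝔞 with hr
  have hr0 : 0 < r := Nat.pos_of_ne_zero fun h => h𝔞 (Ideal.absNorm_eq_zero_iff.mp h)
  have hr𝔞 : ((r : ℤ) : 𝓞 K) ∈ 𝔞 := by rw [Int.cast_natCast, hr]; exact Ideal.absNorm_mem 𝔞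
  have h := card_cubeMod_filter_mem_mul_absNorm hr0 hr𝔞
  rw [← hr] at h
  have : ((cubeMod r).filter (fun ρ => coordElt ρ ∈ 𝔞)).card * r = r ^ 2 * r := by rw [h]; ring
  exact Nat.eq_of_mul_eq_mul_right hr0 this

open scoped Classical in
/-- **(8.5) summed over the class modulo `[J, q]`** (pp. 48–50): for a cube as in Lemma 3.8, `𝐦` of
length `n + 2` (the paper's `n ≥ 1`), a non-zero ideal `J` and `q ≥ 1` with `N(J)q³ ≤ S₀`, and any `α`,
`∑_{β̂ ∈ 𝒞, J ∣ β, β ≡ α (mod q)} w'(N(β)) = [ (J, q) ∣ α ] · N([J, q])⁻¹ 𝓘 + O(S₀³V^{−1/3}(ξ log X)^n) + O(S₀²(ξ log X)^{n+1})`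
("We now observe that `∑_{β ∈ 𝒞, J ∣ β, β ≡ α (mod q)} w'(N(β))` is composed of `r³/N([J, q])` subsums of
the form (8.2), whence `= N([J, q])⁻¹𝓘 + O(S₀²(ξ log X)^n)` providing that `(J, q) ∣ α`", p. 50; when
`(J, q) ∤ α` the sum is empty, p. 47), with the explicit constants of `HeathBrown2001_eq_8_5`: the
error is at most `2106(c₃²/c₄)S₀³V^{−1/3}(ξ log X)^n + 108S₀²(ξ log X)^{n+1}` (the paper's single term
`O(S₀²(ξ log X)^n)` uses `S₀ ≪ V^{1/3}`, `ξ log X ≫ 1` of the application). Here `[J, q] = J ∩ (q)`,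
`(J, q) ∣ α` iff `α ∈ J + (q)`, `r = N([J, q]) ≤ N(J)q³ ≤ S₀`. [cite: HeathBrownActa2001, §8 (8.5)] -/
theorem abs_sum_dvd_class_wDeriv_sub_le (hX : 1 ≤ X) (hτ : 0 ≤ τ) {n : ℕ} (m : Fin (n + 2) → ℕ)
    {c₃ c₄ V : ℝ} (hc₄ : 0 < c₄) (hV : 0 < V) {a : ℝ × ℝ × ℝ} {S₀ : ℝ}
    (hcube : CubeCond c₃ c₄ V a S₀) {J : Ideal (𝓞 K)} (hJ : J ≠ ⊥) {q : ℕ} (hq : 0 < q)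
    (hJq : (Ideal.absNorm J : ℝ) * (q : ℝ) ^ 3 ≤ S₀) (α : 𝓞 K) :
    |∑ v ∈ ((latticeCube a S₀).filter (fun v => (q : 𝓞 K) ∣ coordElt v - α)).filter
          (fun v => J ∣ Ideal.span {coordElt v}),
          wDeriv X τ m (Ideal.absNorm (Ideal.span {coordElt v})) -
        (if α ∈ J ⊔ Ideal.span {(q : 𝓞 K)} then
          ((Ideal.absNorm (J ⊓ Ideal.span {(q : 𝓞 K)}) : ℝ))⁻¹ * cubeIntegral X τ m a S₀ else 0)| ≤
      2106 * (c₃ ^ 2 / c₄) * S₀ ^ 3 * V ^ (-(1 / 3 : ℝ)) * (hbXi τ * Real.log X) ^ n +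
        108 * S₀ ^ 2 * (hbXi τ * Real.log X) ^ (n + 1) := by
  have hX0 : 0 < X := by linarith
  have hξL : 0 ≤ hbXi τ * Real.log X := mul_nonneg (pow_nonneg hτ 5) (Real.log_nonneg hX)
  have hS₀ : 1 ≤ S₀ := by
    have hJ1 : (1 : ℝ) ≤ Ideal.absNorm J := by
      exact_mod_cast Nat.pos_of_ne_zero fun h => hJ (Ideal.absNorm_eq_zero_iff.mp h)
    have hq1 : (1 : ℝ) ≤ (q : ℝ) ^ 3 := one_le_pow₀ (by exact_mod_cast hq)
    nlinarith
  have hRHS : 0 ≤ 2106 * (c₃ ^ 2 / c₄) * S₀ ^ 3 * V ^ (-(1 / 3 : ℝ)) * (hbXi τ * Real.log X) ^ n +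
      108 * S₀ ^ 2 * (hbXi τ * Real.log X) ^ (n + 1) := by
    have : 0 ≤ c₃ ^ 2 / c₄ := div_nonneg (sq_nonneg _) hc₄.le
    have : 0 < V ^ (-(1 / 3 : ℝ)) := Real.rpow_pos_of_pos hV _
    positivity
  -- the summand in the form of (8.5)
  have hsummand : ∀ v ∈ latticeCube a S₀,
      wDeriv X τ m (Ideal.absNorm (Ideal.span {coordElt v})) = wDeriv X τ m (normForm (castVec v)) := by
    intro v hv
    have hvC : castVec v ∈ realCube a S₀ := mem_latticeCube_iff.mp hv
    have hN : c₄ * V ≤ normForm (castVec v) := (hcube _ hvC).2.2.2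
    have hNpos : 0 < normForm (castVec v) := lt_of_lt_of_le (mul_pos hc₄ hV) hN
    rw [absNorm_span_coordElt_real, abs_of_pos]
    · rfl
    · exact hNpos
  by_cases hcompat : α ∈ J ⊔ Ideal.span {(q : 𝓞 K)}
  · -- compatible: one class modulo `𝔞 = J ∩ (q)`
    rw [if_pos hcompat]
    obtain ⟨β₀, h₀J, h₀q⟩ := (exists_mem_and_dvd_sub_iff J q α).mpr hcompat
    obtain ⟨v₀, hv₀⟩ := coordElt_surjective β₀
    set 𝔞 := J ⊓ Ideal.span {(q : 𝓞 K)} with h𝔞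
    set r := Ideal.absNorm 𝔞 with hr
    have h𝔞0 : 𝔞 ≠ ⊥ := inf_span_ne_bot hJ hq
    have hr0 : 0 < r := Nat.pos_of_ne_zero fun h => h𝔞0 (Ideal.absNorm_eq_zero_iff.mp h)
    have hr𝔞 : ((r : ℤ) : 𝓞 K) ∈ 𝔞 := by rw [Int.cast_natCast, hr]; exact Ideal.absNorm_mem 𝔞
    have hrS : (r : ℝ) ≤ S₀ := by
      have h1 : (r : ℝ) ≤ (Ideal.absNorm J : ℝ) * (q : ℝ) ^ 3 := by
        exact_mod_cast absNorm_inf_span_le hJ hq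
      exact h1.trans hJq
    have hr' : (0 : ℝ) < r := by exact_mod_cast hr0
    -- Step 1: the double condition is `β − β₀ ∈ 𝔞`
    have hfilter : ((latticeCube a S₀).filter (fun v => (q : 𝓞 K) ∣ coordElt v - α)).filter
        (fun v => J ∣ Ideal.span {coordElt v}) =
        (latticeCube a S₀).filter (fun v => coordElt v - coordElt v₀ ∈ 𝔞) := by
      rw [Finset.filter_filter]
      refine Finset.filter_congr fun v _ => ?_
      rw [and_comm, hv₀]
      exact dvd_span_and_dvd_sub_iff h₀J h₀q _
    rw [hfilter]
    -- Step 2: the summand, and Step 3: the classes modulo `r`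
    rw [Finset.sum_congr rfl fun v hv => hsummand v (Finset.mem_filter.mp hv).1,
      sum_filter_sub_mem_eq_sum_classes hr0 hr𝔞 v₀]
    set T := (cubeMod r).filter (fun ρ => coordElt ρ ∈ 𝔞) with hT
    have hTcard : (T.card : ℝ) = (r : ℝ) ^ 2 := by
      rw [hT, hr, card_cubeMod_filter_mem_eq_sq h𝔞0]; push_cast; ring
    -- Step 4: (8.5) on each class
    set ℰ : ℝ := 2106 * (c₃ ^ 2 / c₄) * (S₀ ^ 3 / r ^ 2) * V ^ (-(1 / 3 : ℝ)) * (hbXi τ * Real.log X) ^ n +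
      108 * (S₀ ^ 2 / r ^ 2) * (hbXi τ * Real.log X) ^ (n + 1) with hℰ
    have h85 : ∀ ρ ∈ T,
        |∑ v ∈ (latticeCube a S₀).filter (fun v => (r : ℤ) ∣ v.1 - (v₀ + ρ).1 ∧
            (r : ℤ) ∣ v.2.1 - (v₀ + ρ).2.1 ∧ (r : ℤ) ∣ v.2.2 - (v₀ + ρ).2.2),
            wDeriv X τ m (normForm (castVec v)) - ((r : ℝ) ^ 3)⁻¹ * cubeIntegral X τ m a S₀| ≤ ℰ :=
      fun ρ _ => HeathBrown2001_eq_8_5 hX hτ m hc₄ hV hcube hr0 hrS (v₀ + ρ)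
    -- Step 5: sum over the `r²` classes
    have hmain : |∑ ρ ∈ T, ∑ v ∈ (latticeCube a S₀).filter (fun v => (r : ℤ) ∣ v.1 - (v₀ + ρ).1 ∧
            (r : ℤ) ∣ v.2.1 - (v₀ + ρ).2.1 ∧ (r : ℤ) ∣ v.2.2 - (v₀ + ρ).2.2),
            wDeriv X τ m (normForm (castVec v)) - ∑ _ρ ∈ T, (((r : ℝ) ^ 3)⁻¹ * cubeIntegral X τ m a S₀)| ≤
        (T.card : ℝ) * ℰ := by
      rw [← Finset.sum_sub_distrib]
      calc _ ≤ ∑ ρ ∈ T, |∑ v ∈ (latticeCube a S₀).filter (fun v => (r : ℤ) ∣ v.1 - (v₀ + ρ).1 ∧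
            (r : ℤ) ∣ v.2.1 - (v₀ + ρ).2.1 ∧ (r : ℤ) ∣ v.2.2 - (v₀ + ρ).2.2),
            wDeriv X τ m (normForm (castVec v)) - ((r : ℝ) ^ 3)⁻¹ * cubeIntegral X τ m a S₀| :=
            Finset.abs_sum_le_sum_abs _ _
        _ ≤ ∑ ρ ∈ T, ℰ := Finset.sum_le_sum h85
        _ = (T.card : ℝ) * ℰ := by rw [Finset.sum_const, nsmul_eq_mul]
    -- Step 6: `#T · r⁻³ = N(𝔞)⁻¹`, `#T · ℰ = ℰ₀`
    have hTr : ∑ _ρ ∈ T, (((r : ℝ) ^ 3)⁻¹ * cubeIntegral X τ m a S₀) =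
        (r : ℝ)⁻¹ * cubeIntegral X τ m a S₀ := by
      rw [Finset.sum_const, nsmul_eq_mul, hTcard]; field_simp
    have hTℰ : (T.card : ℝ) * ℰ = 2106 * (c₃ ^ 2 / c₄) * S₀ ^ 3 * V ^ (-(1 / 3 : ℝ)) * (hbXi τ * Real.log X) ^ n +
        108 * S₀ ^ 2 * (hbXi τ * Real.log X) ^ (n + 1) := by
      rw [hTcard, hℰ]; field_simp
    rw [hTr, hTℰ] at hmain
    exact hmain
  · -- incompatible: the sum is empty
    rw [if_neg hcompat, sub_zero]
    have hempty : ((latticeCube a S₀).filter (fun v => (q : 𝓞 K) ∣ coordElt v - α)).filter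
        (fun v => J ∣ Ideal.span {coordElt v}) = ∅ := by
      rw [Finset.filter_filter, Finset.filter_eq_empty_iff]
      rintro v - ⟨hqv, hJv⟩
      exact hcompat ((exists_mem_and_dvd_sub_iff J q α).mp
        ⟨coordElt v, Ideal.dvd_span_singleton.mp hJv, hqv⟩)
    rw [hempty, Finset.sum_empty, abs_zero]
    exact hRHS

end Classes

end Literature.NumberTheory.Sieve.CubicSieve

end
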